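import Literature.NumberTheory.Sieve.LinearEquationsInPrimesProofs
import Mathlib.NumberTheory.Primorial
import Mathlib.Data.ZMod.Units
import HarnessLib

/-!
# Linear equations in primes: multiplicativity of the local factors (Green–Tao 2010, §1)

Trunk T-SIEVE (`Literature/NumberTheory/Sieve`). Green–Tao, *Linear equations in primes*,
Ann. of Math. 171 (2010), §1, after (1.6): "From the Chinese remainder theorem we see that this
factor is multiplicative, indeed we have `β_q = ∏_{p | q} β_p`." This is the second input (with
the uniform Lemma 1.3 of `LinearEquationsInPrimesSingularSeries.lean`) of the `W`-trick of §5,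
where it is used in the form `∏_{p ≤ w} β_p = β_W`, `W = ∏_{p ≤ w} p`. Everything here is proved:

* `Literature.localVonMangoldtZMod q` — `Λ_{ℤ/qℤ}` as a function on `ZMod q` (`q/φ(q)` on units, `0`
  otherwise) and `Literature.NumberTheory.Sieve.localVonMangoldt_eq_zmod` (agreement with `localVonMangoldt`, (1.5));
* `Literature.NumberTheory.Sieve.localFactor_eq_sum_zmod` — `β_q = q^{-d} ∑_{v ∈ (ℤ/q)^d} ∏ᵢ Λ_{ℤ/q}(ψᵢ(v))` ((1.6) as an
  honest average over `(ℤ/qℤ)^d`);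
* `Literature.NumberTheory.Sieve.localFactor_mul_of_coprime` — **`β_{qr} = β_q β_r` for coprime `q, r ≥ 1`** (CRT);
* `Literature.NumberTheory.Sieve.localFactor_prod_primes` — `β_{∏_{p ∈ S} p} = ∏_{p ∈ S} β_p` for a finite set of primes;
* `Literature.NumberTheory.Sieve.localFactor_primorial` — `β_W = ∏_{p ≤ w} β_p = singularProductPartial Ψ w` for
  `W = primorial w`.

## References

* B. Green, T. Tao, *Linear equations in primes*, Ann. of Math. (2) 171 (2010), 1753–1850
  (arXiv:math/0606088): (1.5), (1.6) and the sentence following it; §5 ("`W := ∏_{p ≤ w} p`",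
  "`∏_{p ≤ w} β_p + o(1) = β_W + o(1)`").
-/

noncomputable section

open Filter Finset
open scoped Topology

namespace Literature.NumberTheory.Sieve

variable {d t : ℕ}

/-! ### `Λ_{ℤ/qℤ}` on `ZMod q` -/

open Classical in
/-- The local von Mangoldt function as a function on `ℤ/qℤ`: `q/φ(q)` on the units and `0`
elsewhere (classical `if`). [cite: GreenTao2010, (1.5)] -/
def localVonMangoldtZMod (q : ℕ) (x : ZMod q) : ℝ :=
  if IsUnit x then (q : ℝ) / Nat.totient q else 0

/-- `Λ_{ℤ/qℤ}(b)` depends only on `b mod q`: it is `localVonMangoldtZMod q (b mod q)`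
(`gcd(b, q) = 1` iff `b` is a unit mod `q`). [cite: GreenTao2010, (1.5)] -/
theorem localVonMangoldt_eq_zmod (q : ℕ) (b : ℤ) :
    localVonMangoldt q b = localVonMangoldtZMod q (b : ZMod q) := by
  have key : Int.gcd b q = 1 ↔ IsUnit ((b : ℤ) : ZMod q) := by
    rw [ZMod.coe_int_isUnit_iff_isCoprime, Int.isCoprime_iff_gcd_eq_one, Int.gcd_comm]
  unfold localVonMangoldt localVonMangoldtZMod
  by_cases h : Int.gcd b q = 1
  · rw [if_pos h, if_pos (key.mp h)]
  · rw [if_neg h, if_neg (fun h' => h (key.mpr h'))]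

/-- `Λ_{ℤ/qℤ} ≥ 0` on `ZMod q`. [folklore] -/
theorem localVonMangoldtZMod_nonneg (q : ℕ) (x : ZMod q) : 0 ≤ localVonMangoldtZMod q x := by
  unfold localVonMangoldtZMod
  split_ifs <;> positivity

/-! ### `β_q` as an average over `(ℤ/qℤ)^d` -/

/-- (1.6) as an average over `(ℤ/qℤ)^d`:
`β_q = q^{-d} ∑_{v ∈ (ℤ/qℤ)^d} ∏ᵢ Λ_{ℤ/qℤ}(ψᵢ(v))`. [cite: GreenTao2010, (1.6)] -/
theorem localFactor_eq_sum_zmod (Ψ : Fin t → AffLinForm d) (q : ℕ) [NeZero q] :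
    localFactor Ψ q =
      ((q : ℝ) ^ d)⁻¹ * ∑ v : Fin d → ZMod q, ∏ i, localVonMangoldtZMod q ((Ψ i).modEval q v) := by
  unfold localFactor
  congr 1
  have h1 : ∀ n ∈ Fintype.piFinset (fun _ : Fin d => range q),
      ∏ i, localVonMangoldt q ((Ψ i).eval fun j => (n j : ℤ)) =
        ∏ i, localVonMangoldtZMod q ((Ψ i).modEval q fun j => ((n j : ℕ) : ZMod q)) := by
    intro n _
    refine Finset.prod_congr rfl fun i _ => ?_
    rw [localVonMangoldt_eq_zmod, AffLinForm.intCast_eval]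
    simp only [Int.cast_natCast]
  rw [Finset.sum_congr rfl h1]
  exact sum_piFinset_range_eq_sum_zmod q
    (fun v => ∏ i, localVonMangoldtZMod q ((Ψ i).modEval q v))

/-! ### The Chinese remainder theorem -/

/-- Reduction of the forms is compatible with ring homomorphisms `ZMod m → ZMod q`.
[folklore] -/
theorem AffLinForm.map_modEval (ψ : AffLinForm d) {m q : ℕ} (f : ZMod m →+* ZMod q)
    (v : Fin d → ZMod m) : f (ψ.modEval m v) = ψ.modEval q (fun j => f (v j)) := by
  simp [AffLinForm.modEval, map_sum, map_add, map_mul, map_intCast]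

/-- `Λ_{ℤ/qr}(x) = Λ_{ℤ/q}(x) Λ_{ℤ/r}(x)` for coprime `q, r` (a residue is a unit mod `qr` iff it
is a unit mod `q` and mod `r`; `φ(qr) = φ(q) φ(r)`). [cite: GreenTao2010, (1.6) (multiplicativity)] -/
theorem localVonMangoldtZMod_mul {q r : ℕ} (h : q.Coprime r) (x : ZMod (q * r)) :
    localVonMangoldtZMod (q * r) x =
      localVonMangoldtZMod q (ZMod.chineseRemainder h x).1 *
        localVonMangoldtZMod r (ZMod.chineseRemainder h x).2 := by
  have hunit : IsUnit x ↔ IsUnit (ZMod.chineseRemainder h x).1 ∧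
      IsUnit (ZMod.chineseRemainder h x).2 := by
    rw [← Prod.isUnit_iff]
    exact (MulEquiv.isUnit_map (ZMod.chineseRemainder h).toMulEquiv (x := x)).symm
  unfold localVonMangoldtZMod
  by_cases hx : IsUnit x
  · obtain ⟨h1, h2⟩ := hunit.mp hx
    rw [if_pos hx, if_pos h1, if_pos h2, Nat.totient_mul h]
    push_cast
    rw [div_mul_div_comm]
  · rw [if_neg hx]
    by_cases h1 : IsUnit (ZMod.chineseRemainder h x).1
    · have h2 : ¬ IsUnit (ZMod.chineseRemainder h x).2 := fun h2 => hx (hunit.mpr ⟨h1, h2⟩)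
      rw [if_neg h2, mul_zero]
    · rw [if_neg h1, zero_mul]

/-- **Multiplicativity of the local factors** (Green–Tao 2010, after (1.6): "From the Chinese
remainder theorem we see that this factor is multiplicative"): `β_{qr} = β_q β_r` for coprime
`q, r ≥ 1`. [cite: GreenTao2010, (1.6) and the following sentence] -/
theorem localFactor_mul_of_coprime (Ψ : Fin t → AffLinForm d) {q r : ℕ} [NeZero q] [NeZero r]
    (h : q.Coprime r) : localFactor Ψ (q * r) = localFactor Ψ q * localFactor Ψ r := by
  haveI : NeZero (q * r) := ⟨mul_ne_zero (NeZero.ne q) (NeZero.ne r)⟩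
  rw [localFactor_eq_sum_zmod, localFactor_eq_sum_zmod, localFactor_eq_sum_zmod]
  set e := ZMod.chineseRemainder h with he
  -- the CRT bijection on `(ℤ/qr)^d`
  let E : (Fin d → ZMod (q * r)) ≃ (Fin d → ZMod q) × (Fin d → ZMod r) :=
    (Equiv.piCongrRight fun _ : Fin d => e.toEquiv).trans
      (Equiv.arrowProdEquivProdArrow (Fin d) (fun _ => ZMod q) fun _ => ZMod r)
  have hsum : ∑ v : Fin d → ZMod (q * r), ∏ i, localVonMangoldtZMod (q * r) ((Ψ i).modEval (q * r) v)
      = ∑ w : (Fin d → ZMod q) × (Fin d → ZMod r),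
          (∏ i, localVonMangoldtZMod q ((Ψ i).modEval q w.1)) *
            ∏ i, localVonMangoldtZMod r ((Ψ i).modEval r w.2) := by
    refine Fintype.sum_equiv E _ _ fun v => ?_
    show _ = (∏ i, localVonMangoldtZMod q ((Ψ i).modEval q fun j => (e (v j)).1)) *
      ∏ i, localVonMangoldtZMod r ((Ψ i).modEval r fun j => (e (v j)).2)
    rw [← Finset.prod_mul_distrib]
    refine Finset.prod_congr rfl fun i _ => ?_
    rw [localVonMangoldtZMod_mul h]
    have h1 : (e ((Ψ i).modEval (q * r) v)).1 = (Ψ i).modEval q fun j => (e (v j)).1 := by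
      have := AffLinForm.map_modEval (Ψ i) ((RingHom.fst _ _).comp e.toRingHom) v
      simpa using this
    have h2 : (e ((Ψ i).modEval (q * r) v)).2 = (Ψ i).modEval r fun j => (e (v j)).2 := by
      have := AffLinForm.map_modEval (Ψ i) ((RingHom.snd _ _).comp e.toRingHom) v
      simpa using this
    rw [h1, h2]
  rw [hsum, Fintype.sum_prod_type]
  dsimp only
  rw [← Finset.sum_mul_sum]
  push_cast
  rw [mul_pow, mul_inv]
  ring

/-- `β_{∏_{p ∈ S} p} = ∏_{p ∈ S} β_p` for a finite set `S` of primes.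
[cite: GreenTao2010, (1.6) and the following sentence] -/
theorem localFactor_prod_primes (Ψ : Fin t → AffLinForm d) (S : Finset ℕ)
    (hS : ∀ p ∈ S, p.Prime) : localFactor Ψ (∏ p ∈ S, p) = ∏ p ∈ S, localFactor Ψ p := by
  induction S using Finset.induction_on with
  | empty =>
    -- `β_1 = 1`: every residue is a unit mod `1` and `1/φ(1) = 1`
    rw [Finset.prod_empty, Finset.prod_empty, localFactor_eq_sum_zmod]
    have h1 : ∀ v : Fin d → ZMod 1, ∏ i, localVonMangoldtZMod 1 ((Ψ i).modEval 1 v) = 1 := by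
      intro v
      refine Finset.prod_eq_one fun i _ => ?_
      rw [localVonMangoldtZMod, if_pos (isUnit_of_subsingleton _)]
      simp
    simp [h1]
  | insert p S hp ih =>
    have hpP : p.Prime := hS p (Finset.mem_insert_self _ _)
    have hS' : ∀ p' ∈ S, p'.Prime := fun p' hp' => hS p' (Finset.mem_insert_of_mem hp')
    rw [Finset.prod_insert hp, Finset.prod_insert hp]
    have hcop : p.Coprime (∏ p' ∈ S, p') :=
      Nat.Coprime.prod_right fun p' hp' =>
        (Nat.coprime_primes hpP (hS' p' hp')).mpr fun hh => hp (hh ▸ hp')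
    haveI : NeZero p := ⟨hpP.ne_zero⟩
    haveI : NeZero (∏ p' ∈ S, p') :=
      ⟨Finset.prod_ne_zero_iff.mpr fun p' hp' => (hS' p' hp').ne_zero⟩
    rw [localFactor_mul_of_coprime Ψ hcop, ih hS']

/-- **`β_W = ∏_{p ≤ w} β_p`** for `W = ∏_{p ≤ w} p = primorial w`: the form in which
multiplicativity enters the `W`-trick ("`∏_p β_p = ∏_{p ≤ w} β_p + o(1) = β_W + o(1)`").
[cite: GreenTao2010, §5 (Proof of the Main Theorem assuming Theorem 5.1)] -/
theorem localFactor_primorial (Ψ : Fin t → AffLinForm d) (w : ℕ) :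
    localFactor Ψ (primorial w) = singularProductPartial Ψ w := by
  unfold singularProductPartial primorial
  rw [← Nat.primesLE_eq_filter_range]
  exact localFactor_prod_primes Ψ _ fun p hp => (Nat.mem_primesLE.mp hp).2

end Literature.NumberTheory.Sieve
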